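import Summits.QuantumFields.BalabanUV.T4Continuum.Spine.NE3.FrameNormalisation
import Summits.QuantumFields.BalabanUV.T4Continuum.Spine.NE3.FrameNormalisationAdmissible
import Summits.QuantumFields.BalabanUV.T4Continuum.Spine.NE3.FrameNormalisationAdmissibleTop
import Summits.QuantumFields.BalabanUV.T4Continuum.Spine.NE3.FrameNormalisationSize
import HarnessLib

/-!
# T⁴ programme, node NE3 — census R50 (M4) CLOSED: THE ZEROTH-ORDER FRAME GAUGE IS ADMISSIBLE — unitary, `(N·L^k)`-periodic, realises the frame condition and (1.37)
# at a level-`k` pair, and (pinned pre-gauge) lies within `64·d·L^k·b` of `1` (`FrameNormalisationAdmissibleGauge`)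

Cell `pub-balaban-gaps` (track G2, seat ne3, generation 11), row NE3; census `HOME/ne/NE3.md` §4 R50 (M4), §17.  This module ASSEMBLES the four R50 bricks into the admissible
zeroth-order realisation of [Balaban1985RegularSpaces] (1.29)∕(1.37) by a hierarchically block-covariantly-constant moving-frame gauge:

* `FrameNormalisation.exists_hier_extension` ∕ `frameCondition(')` — the gauge `v` with top corner data `u₀(L^kz)⁻¹·v_k(U₀′)(z)` (general pre-gauge `u₀`, `U_A^{u₀} = U₀′·W`)
  or `v_k(U₀′)(z)` (pinned pre-gauge, `u₀(L^kz) = 1`), block-covariantly constant at every level `i < k` relative to `Ū₀ⁱ = avgIter L W i`; `u := v·u₀`, `U′ := U₀′^{v}`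
  satisfy `U_A^{u} = U′·W` and the frame condition `v_k(U′) = u_k` ([Balaban1985Averaging] (96)–(99));
* `FrameNormalisationAdmissible.mem_of_hier` ∕ `periodic_of_hier` — subgroup membership and periodicity propagate from the top data down the hierarchy;
* `FrameNormalisationAdmissibleTop.vcov_mem_unitaryUnits` ∕ `topData_mem_unitaryUnits` ∕ `vcov_add_period` — the top data are unitary ([Balaban1985RegularSpaces] Prop. 7's
  tower, `B8Prop7AdmittedFamily`) and `N`-periodic on `Ω^{(k)}` (translation covariance of (91)∕(97));
* `FrameNormalisationSize.norm_frameGauge_sub_one_le` — for the pinned pre-gauge, `‖v(x) − 1‖ ≤ 64·d·L^k·b` everywhere ([Balaban1985Averaging] (163)).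

What is proved here (0 def, 0 sorry; `U₀′ = e^{B}`, `sup‖B‖ ≤ b`, unitary `(N·L^k)`-periodic background `W` in the regime of [Balaban1985Averaging] Prop. 4 and of
[Balaban1985RegularSpaces] Prop. 7, unitary `(N·L^k)`-periodic pre-gauge `u₀`, `2 ≤ L`):

* §1 `avgIter_add_period` — the `i`-fold average of an `(N·L^k)`-periodic configuration is `(N·L^{k−i})`-periodic (`B7TranslationCovariance.avgIter_shiftCfg`): the hypothesis
  `hWP` of `periodic_of_hier`, discharged.
* §2 `mul_mem_of` ∕ `mul_add_period` ∕ `mgauge_mem_of` ∕ `mgauge_add_period` — the output gauge `v·u₀` and the output perturbation `U₀′^{v}` ((55)) inherit subgroup membership and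
  periodicity (group algebra).
* §3 **`unitary_periodic_of_hier`** — a hierarchically block-covariantly-constant `v` with the frame top data is UNITARY EVERYWHERE and `(N·L^k)`-PERIODIC.
* §4 **`exists_admissibleFrameNormalised'`** (general pre-gauge) ∕ **`exists_admissibleFrameNormalised`** (pinned pre-gauge, with the size letter) — THE ADMISSIBLE ZEROTH-ORDER
  FRAME GAUGE EXISTS AT EVERY ORDER `k`: `v` unitary, `(N·L^k)`-periodic, `U_A^{v·u₀} = U₀′^{v}·W`, `vcov L W (U₀′^{v}) k = uLev L (v·u₀) k`; and
  **`exists_admissibleFrameNormalised'_pair`** — at a pair (`Ū_Aᵏ = V = W̄ᵏ`) moreover (1.37) `dbavgCovIter L W (U₀′^{v}) k = 1`, with the output gauge `v·u₀` and the output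
  perturbation `U₀′^{v}` unitary and `(N·L^k)`-periodic — i.e. the data have the ADMISSIBILITY that THE END's `LandauRepB8Avg` asks of a gauge (`IsUnitarySite`-,
  `IsPeriodicSite`-type clauses), at the zeroth order.
* §5 `norm_mgauge_sub_one_le` — `‖U′^{v}(b) − 1‖ ≤ r + 2δ` for unitary data with `‖v − 1‖ ≤ δ`, `‖U′ − 1‖ ≤ r` ((55) is a product of three units); hence
  **`exists_admissibleFrameNormalised_pair`** (pinned pre-gauge at a pair): everything above AND the OUTPUT LETTER `‖(e^{B})^{v}(b) − 1‖ ≤ r + 128·d·L^k·b` — the located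
  face jump of the exact realisation as a kernel UPPER bound (`r + 128·d·s₁` at `b = s₁ξ`, `L^k = ξ⁻¹`: (0)-size, where (1.36) asks (−1)-size).

WHAT THIS IS NOT (honest, located; unchanged from `FrameNormalisation`).  The realisation is EXACT for (1.37) but only ZEROTH-ORDER for (1.36): a piecewise covariantly-constant
gauge jumps across block faces by the corner oscillation of `v_k(U₀′)`, of order `64·d·L^k·b` = `64·d·s₁` at `b = s₁ξ` — (0)-size against the (−1)-size sup member of (1.36).
The (1.36)-compatible realisation (smooth corner interpolation + fixed point, jointly with the (1.38)-Landau step — [Balaban1985RegularSpaces] Sect. E (1.100)) is census R50's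
open half (M1), or the synthesis R53 ((M2) second-order frame letter + (M3) tower re-issue).  Nothing of Bałaban's is asserted: group algebra and bookkeeping over landed theorems BY
NAME.  **NE3 NOT proved**; `PairLandauGaugeB8Avg` and the covariant root NOT proved; spine PROVED 0∕9; finite T⁴ rung (B)+1 — NOT continuum YM on ℝ⁴, NOT infinite volume, NOT
mass gap, NOT `BetaPertH`, NOT Clay.  HONEST DEPENDENCY: continuum YM on T⁴ ⇐ BetaPertH ∧ nine spine estimates (0/9 proved); BetaPertH ⇐ (D1) ∧ (D4) ∧ CAP+tail; G-an2-4 gates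
asym, D1 and NE2/3/4.  PLACEMENT: `Summits/QuantumFields/BalabanUV/T4Continuum/Spine/NE3/`; imports the four R50 bricks `FrameNormalisation`, `FrameNormalisationAdmissible`,
`FrameNormalisationAdmissibleTop`, `FrameNormalisationSize`.

References: [Balaban1985Averaging] T. Bałaban, *Averaging operations for lattice gauge theories*, CMP 98 (1985) 17–51: (43) p. 24, (55) p. 27, (96)–(99) p. 32, (163) p. 42;
[Balaban1985RegularSpaces] T. Bałaban, *Spaces of regular gauge field configurations on a lattice and gauge fixing conditions*, CMP 99 (1985) 75–102: (1.29) p. 80, (1.36)–(1.37)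
p. 82, Prop. 7 p. 94.
-/

set_option autoImplicit false

open scoped BigOperators Matrix Matrix.Norms.L2Operator
open NormedSpace

namespace Summit.QuantumFields.BalabanUV.T4Continuum.NE3.FrameNormalisationAdmissibleGauge

open Literature.MathematicalPhysics.QuantumFieldTheory.Balaban1983to89
open B7Prop1Explicit B7Prop2Explicit B7Prop3Flat MatrixLog
open B7AvgGaugeCovariance (uLev uLev_apply)
open B7Eq92Concrete (Rc Rc_apply mgauge mgauge_apply vcov dbavgCovIter)
open B12Ineq417Flat (shiftCfg shiftCfg_apply)
open B7TranslationCovariance (avgIter_shiftCfg)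
open NE3.FrameNormalisationOneLevel (dbavgCovIter_eq_one_of_frame_eq')
open NE3.FrameNormalisation (exists_hier_extension frameCondition frameCondition')
open NE3.FrameNormalisationAdmissible (mem_of_hier periodic_of_hier)
open NE3.FrameNormalisationAdmissibleTop (vcov_add_period vcov_mem_unitaryUnits topData_mem_unitaryUnits)
open NE3.FrameNormalisationSize (norm_frameGauge_sub_one_le)

noncomputable section

variable {d : ℕ} {n : Type*} [Fintype n] [DecidableEq n]

/-! ## §1 Periodicity of the averaged backgrounds -/

/-- **THE `i`-FOLD AVERAGE OF AN `(N·L^k)`-PERIODIC CONFIGURATION IS `(N·L^{k−i})`-PERIODIC** (`i ≤ k`): translation covariance of (43) (`avgIter_shiftCfg`: translating `Ω^{(i)}` by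
`a` translates the fine lattice by `L^i a`, and `L^i·N·L^{k−i} = N·L^k` is a period). [folklore] -/
theorem avgIter_add_period (L N k : ℕ) {W : Site d → Fin d → (Matrix n n ℂ)ˣ}
    (hWP : ∀ (x : Site d) (κ : Fin d) (j : Fin d), W (x + ((N * L ^ k : ℕ) : ℤ) • e j) κ = W x κ) :
    ∀ i ≤ k, ∀ (x : Site d) (κ : Fin d) (j : Fin d), avgIter L W i (x + ((N * L ^ (k - i) : ℕ) : ℤ) • e j) κ = avgIter L W i x κ := by
  intro i hi x κ j
  have hik : i + (k - i) = k := by omega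
  have hs : ((L : ℤ) ^ i) • ((((N * L ^ (k - i) : ℕ) : ℤ)) • e j) = (((N * L ^ k : ℕ) : ℤ)) • e j := by
    rw [smul_smul]
    congr 1
    push_cast
    rw [mul_left_comm, ← pow_add, hik]
  have hW : shiftCfg (((L : ℤ) ^ i) • ((((N * L ^ (k - i) : ℕ) : ℤ)) • e j)) W = W := by
    funext y μ
    rw [shiftCfg_apply, hs, hWP]
  rw [avgIter_shiftCfg L W i _ x κ, hW]

/-! ## §2 The output gauge `v·u₀` and the output perturbation `U₀′^{v}` inherit subgroup membership and periodicity -/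

/-- A pointwise product of `G`-valued gauges is `G`-valued. [folklore] -/
theorem mul_mem_of {G : Subgroup (Matrix n n ℂ)ˣ} {v u₀ : Site d → (Matrix n n ℂ)ˣ} (hv : ∀ x : Site d, v x ∈ G) (hu : ∀ x : Site d, u₀ x ∈ G)
    (x : Site d) : (v * u₀) x ∈ G :=
  G.mul_mem (hv x) (hu x)

/-- A pointwise product of `p`-periodic gauges is `p`-periodic. [folklore] -/
theorem mul_add_period {v u₀ : Site d → (Matrix n n ℂ)ˣ} {p : Site d} (hv : ∀ x : Site d, v (x + p) = v x) (hu : ∀ x : Site d, u₀ (x + p) = u₀ x)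
    (x : Site d) : (v * u₀) (x + p) = (v * u₀) x := by
  rw [Pi.mul_apply, Pi.mul_apply, hv, hu]

/-- **THE MOVING-FRAME TRANSFORM (55) `U′^{v} = v(x)·U′(x,κ)·(R(W(x,κ)) v(x+e_κ))⁻¹` IS `G`-VALUED** for `G`-valued `W`, `U′`, `v`. [folklore] -/
theorem mgauge_mem_of {G : Subgroup (Matrix n n ℂ)ˣ} {W U' : Site d → Fin d → (Matrix n n ℂ)ˣ} {v : Site d → (Matrix n n ℂ)ˣ}
    (hW : ∀ (x : Site d) (κ : Fin d), W x κ ∈ G) (hU : ∀ (x : Site d) (κ : Fin d), U' x κ ∈ G) (hv : ∀ x : Site d, v x ∈ G)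
    (x : Site d) (κ : Fin d) : mgauge W v U' x κ ∈ G := by
  rw [mgauge_apply, Rc_apply]
  exact G.mul_mem (G.mul_mem (hv x) (hU x κ)) (G.inv_mem (G.mul_mem (G.mul_mem (hW x κ) (hv _)) (G.inv_mem (hW x κ))))

/-- **THE MOVING-FRAME TRANSFORM (55) OF `p`-PERIODIC DATA IS `p`-PERIODIC.** [folklore] -/
theorem mgauge_add_period {W U' : Site d → Fin d → (Matrix n n ℂ)ˣ} {v : Site d → (Matrix n n ℂ)ˣ} {p : Site d}
    (hW : ∀ (x : Site d) (κ : Fin d), W (x + p) κ = W x κ) (hU : ∀ (x : Site d) (κ : Fin d), U' (x + p) κ = U' x κ)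
    (hv : ∀ x : Site d, v (x + p) = v x) (x : Site d) (κ : Fin d) :
    mgauge W v U' (x + p) κ = mgauge W v U' x κ := by
  rw [mgauge_apply, mgauge_apply, add_right_comm x p (e κ), hW, hU, hv, hv]

/-! ## §3 The hierarchical frame gauge is unitary and periodic -/

/-- **A HIERARCHICALLY BLOCK-COVARIANTLY-CONSTANT GAUGE WITH THE FRAME TOP DATA `u₀(L^kz)⁻¹·v_k(e^{B})(z)` IS UNITARY EVERYWHERE AND `(N·L^k)`-PERIODIC**, for a unitary
`(N·L^k)`-periodic background `W` in the regime of [Balaban1985Averaging] Prop. 4 (so that every `Ū₀ⁱ` is unitary, `B7Prop2Explicit.avgIter_mem`, and `(N·L^{k−i})`-periodic, §1),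
unitary `(N·L^k)`-periodic `e^{B}` with the tower hypotheses of [Balaban1985RegularSpaces] Prop. 7 (so that `v_k(e^{B})` is unitary, `FrameNormalisationAdmissibleTop.vcov_mem_unitaryUnits`,
and `N`-periodic, `vcov_add_period`), and a unitary `(N·L^k)`-periodic pre-gauge `u₀`: by `FrameNormalisationAdmissible.mem_of_hier` ∕ `periodic_of_hier`. [folklore] -/
theorem unitary_periodic_of_hier [Nonempty n] (hd : 1 ≤ d) {L : ℕ} (hL : 2 ≤ L) (k N : ℕ)
    {u₀ : Site d → (Matrix n n ℂ)ˣ} {W : Site d → Fin d → (Matrix n n ℂ)ˣ} {B : Site d → Fin d → Matrix n n ℂ} {α₀ αP b : ℝ}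
    (hWu : ∀ (x : Site d) (κ : Fin d), W x κ ∈ unitaryUnits (Matrix n n ℂ))
    (hWP : ∀ (x : Site d) (κ : Fin d) (j : Fin d), W (x + ((N * L ^ k : ℕ) : ℤ) • e j) κ = W x κ)
    (hBu : ∀ (x : Site d) (κ : Fin d), expCfg B x κ ∈ unitaryUnits (Matrix n n ℂ))
    (hBP : ∀ (x : Site d) (κ : Fin d) (j : Fin d), expCfg B (x + ((N * L ^ k : ℕ) : ℤ) • e j) κ = expCfg B x κ)
    (hα : 0 < α₀) (hα3 : C0 d * α₀ ≤ 1 / 3) (hα4 : 4 * α₀ ≤ c2' d L) (h52 : pdev W < α₀ * (((L : ℝ) ^ k)⁻¹) ^ 2)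
    (hb : 0 ≤ b) (hB : ∀ (x : Site d) (κ : Fin d), ‖B x κ‖ ≤ b)
    (hsmall : Real.exp (4 * (800 * ((d : ℝ) + 1) ^ 2 * ((d : ℝ) + 4)) * α₀) * (1 + 8 * (131072 * ((d : ℝ) + 1) ^ 2) * ((L : ℝ) ^ k * b)) ≤ 2)
    (hc₃ : 2 * ((L : ℝ) ^ k * b) ≤ c3 d L) (hsm : 2048 * (d : ℝ) * ((L : ℝ) ^ k * b) ≤ 1)
    (hαP : 0 < αP) (hαP3 : C0 d * αP ≤ 1 / 3) (hαP2 : 2 * αP ≤ c2' d L) (hP : pdev (expCfg B * W) < αP * (((L : ℝ) ^ k)⁻¹) ^ 2)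
    (hu₀u : ∀ x : Site d, u₀ x ∈ unitaryUnits (Matrix n n ℂ))
    (hu₀P : ∀ (x : Site d) (j : Fin d), u₀ (x + ((N * L ^ k : ℕ) : ℤ) • e j) = u₀ x)
    {v : Site d → (Matrix n n ℂ)ˣ}
    (htop : ∀ z : Site d, v (((L : ℤ) ^ k) • z) = (u₀ (((L : ℤ) ^ k) • z))⁻¹ * vcov L W (expCfg B) k z)
    (hhier : ∀ i < k, ∀ (y : Site d) (r : Fin d → Fin L),
      Rc (hol (avgIter L W i) ((L : ℤ) • y) (treeWord (boxVec L r))) (uLev L v i ((L : ℤ) • y + boxVec L r)) = uLev L v i ((L : ℤ) • y)) :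
    (∀ x : Site d, v x ∈ unitaryUnits (Matrix n n ℂ)) ∧
      ∀ (x : Site d) (j : Fin d), v (x + ((N * L ^ k : ℕ) : ℤ) • e j) = v x := by
  letI : CStarAlgebra (Matrix n n ℂ) := {}
  have hL1 : 1 ≤ L := by omega
  have hG := avgClosed_unitaryUnits d (𝔸 := Matrix n n ℂ) L
  have hα2 : 2 * α₀ ≤ c2' d L := by linarith
  have hunit := avgIter_mem L hL hG k W hWu hα hα3 hα2 h52
  have hvk : ∀ z : Site d, vcov L W (expCfg B) k z ∈ unitaryUnits (Matrix n n ℂ) :=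
    vcov_mem_unitaryUnits hd hL hWu hBu hα hα3 hα4 h52 hb hB hsmall hc₃ hsm hαP hαP3 hαP2 hP
  refine ⟨mem_of_hier hL1 k (unitaryUnits (Matrix n n ℂ)) (fun i hi x κ => hunit i hi.le x κ) hhier fun z => ?_,
    periodic_of_hier hL1 k N (fun i hi x κ j => avgIter_add_period L N k hWP i hi.le x κ j) hhier fun z j => ?_⟩
  · rw [htop z]
    exact topData_mem_unitaryUnits hu₀u hvk z
  · have hs : ((L : ℤ) ^ k) • (z + (N : ℤ) • e j) = ((L : ℤ) ^ k) • z + (((N * L ^ k : ℕ) : ℤ)) • e j := by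
      rw [smul_add, smul_smul, show ((L : ℤ) ^ k) * (N : ℤ) = (((N * L ^ k : ℕ) : ℤ)) by push_cast; ring]
    rw [htop, htop, hs, hu₀P, vcov_add_period L N k hWP hBP z j]

/-! ## §4 The admissible zeroth-order frame gauge -/

/-- **THE ADMISSIBLE FRAME NORMALISATION FROM AN ARBITRARY UNITARY PERIODIC PRE-GAUGE, EVERY ORDER `k`** (`2 ≤ L`; regime of §3): with `U_A^{u₀} = e^{B}·W` there is a
hierarchically block-covariantly-constant `v` with top data `u₀(L^kz)⁻¹·v_k(e^{B})(z)`, UNITARY everywhere and `(N·L^k)`-PERIODIC, such that `u := v·u₀`, `U′ := (e^{B})^{v}` satisfy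
`U_A^{u} = U′·W` and the frame condition `vcov L W U′ k = uLev L u k` ([Balaban1985Averaging] (96)–(99); `FrameNormalisation.frameCondition'`). [folklore] -/
theorem exists_admissibleFrameNormalised' [Nonempty n] (hd : 1 ≤ d) {L : ℕ} (hL : 2 ≤ L) (k N : ℕ)
    {u₀ : Site d → (Matrix n n ℂ)ˣ} {UA W : Site d → Fin d → (Matrix n n ℂ)ˣ} {B : Site d → Fin d → Matrix n n ℂ} {α₀ αP b : ℝ}
    (hWu : ∀ (x : Site d) (κ : Fin d), W x κ ∈ unitaryUnits (Matrix n n ℂ))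
    (hWP : ∀ (x : Site d) (κ : Fin d) (j : Fin d), W (x + ((N * L ^ k : ℕ) : ℤ) • e j) κ = W x κ)
    (hBu : ∀ (x : Site d) (κ : Fin d), expCfg B x κ ∈ unitaryUnits (Matrix n n ℂ))
    (hBP : ∀ (x : Site d) (κ : Fin d) (j : Fin d), expCfg B (x + ((N * L ^ k : ℕ) : ℤ) • e j) κ = expCfg B x κ)
    (hα : 0 < α₀) (hα3 : C0 d * α₀ ≤ 1 / 3) (hα4 : 4 * α₀ ≤ c2' d L) (h52 : pdev W < α₀ * (((L : ℝ) ^ k)⁻¹) ^ 2)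
    (hb : 0 ≤ b) (hB : ∀ (x : Site d) (κ : Fin d), ‖B x κ‖ ≤ b)
    (hsmall : Real.exp (4 * (800 * ((d : ℝ) + 1) ^ 2 * ((d : ℝ) + 4)) * α₀) * (1 + 8 * (131072 * ((d : ℝ) + 1) ^ 2) * ((L : ℝ) ^ k * b)) ≤ 2)
    (hc₃ : 2 * ((L : ℝ) ^ k * b) ≤ c3 d L) (hsm : 2048 * (d : ℝ) * ((L : ℝ) ^ k * b) ≤ 1)
    (hαP : 0 < αP) (hαP3 : C0 d * αP ≤ 1 / 3) (hαP2 : 2 * αP ≤ c2' d L) (hP : pdev (expCfg B * W) < αP * (((L : ℝ) ^ k)⁻¹) ^ 2)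
    (hu₀u : ∀ x : Site d, u₀ x ∈ unitaryUnits (Matrix n n ℂ))
    (hu₀P : ∀ (x : Site d) (j : Fin d), u₀ (x + ((N * L ^ k : ℕ) : ℤ) • e j) = u₀ x)
    (hrep₀ : gaugeAct u₀ UA = expCfg B * W) :
    ∃ v : Site d → (Matrix n n ℂ)ˣ,
      (∀ z : Site d, v (((L : ℤ) ^ k) • z) = (u₀ (((L : ℤ) ^ k) • z))⁻¹ * vcov L W (expCfg B) k z) ∧
      (∀ i < k, ∀ (y : Site d) (r : Fin d → Fin L),
        Rc (hol (avgIter L W i) ((L : ℤ) • y) (treeWord (boxVec L r))) (uLev L v i ((L : ℤ) • y + boxVec L r)) = uLev L v i ((L : ℤ) • y)) ∧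
      (∀ x : Site d, v x ∈ unitaryUnits (Matrix n n ℂ)) ∧
      (∀ (x : Site d) (j : Fin d), v (x + ((N * L ^ k : ℕ) : ℤ) • e j) = v x) ∧
      gaugeAct (v * u₀) UA = mgauge W v (expCfg B) * W ∧
      vcov L W (mgauge W v (expCfg B)) k = uLev L (v * u₀) k := by
  obtain ⟨v, htop, hhier⟩ :=
    exists_hier_extension (show 1 ≤ L by omega) W k (fun z => (u₀ (((L : ℤ) ^ k) • z))⁻¹ * vcov L W (expCfg B) k z)
  obtain ⟨hu, hp⟩ := unitary_periodic_of_hier hd hL k N hWu hWP hBu hBP hα hα3 hα4 h52 hb hB hsmall hc₃ hsm hαP hαP3 hαP2 hP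
    hu₀u hu₀P htop hhier
  obtain ⟨hrep, hframe⟩ := frameCondition' L k hrep₀ htop hhier
  exact ⟨v, htop, hhier, hu, hp, hrep, hframe⟩

/-- **THE ADMISSIBLE FRAME NORMALISATION FROM A PINNED PRE-GAUGE, WITH THE SIZE LETTER** (`u₀(L^kz) = 1`; regime of §3): the hierarchical extension `v` of the top data
`v_k(e^{B})(z)` is UNITARY, `(N·L^k)`-PERIODIC, realises `U_A^{v·u₀} = (e^{B})^{v}·W` and the frame condition, and satisfies **`‖v(x) − 1‖ ≤ 64·d·L^k·b`** everywhere
([Balaban1985Averaging] (163), `FrameNormalisationSize.norm_frameGauge_sub_one_le`) — the located (0)-size of the exact realisation. [folklore] -/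
theorem exists_admissibleFrameNormalised [Nonempty n] (hd : 1 ≤ d) {L : ℕ} (hL : 2 ≤ L) (k N : ℕ)
    {u₀ : Site d → (Matrix n n ℂ)ˣ} {UA W : Site d → Fin d → (Matrix n n ℂ)ˣ} {B : Site d → Fin d → Matrix n n ℂ} {α₀ αP b : ℝ}
    (hWu : ∀ (x : Site d) (κ : Fin d), W x κ ∈ unitaryUnits (Matrix n n ℂ))
    (hWP : ∀ (x : Site d) (κ : Fin d) (j : Fin d), W (x + ((N * L ^ k : ℕ) : ℤ) • e j) κ = W x κ)
    (hBu : ∀ (x : Site d) (κ : Fin d), expCfg B x κ ∈ unitaryUnits (Matrix n n ℂ))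
    (hBP : ∀ (x : Site d) (κ : Fin d) (j : Fin d), expCfg B (x + ((N * L ^ k : ℕ) : ℤ) • e j) κ = expCfg B x κ)
    (hα : 0 < α₀) (hα3 : C0 d * α₀ ≤ 1 / 3) (hα4 : 4 * α₀ ≤ c2' d L) (h52 : pdev W < α₀ * (((L : ℝ) ^ k)⁻¹) ^ 2)
    (hb : 0 ≤ b) (hB : ∀ (x : Site d) (κ : Fin d), ‖B x κ‖ ≤ b)
    (hsmall : Real.exp (4 * (800 * ((d : ℝ) + 1) ^ 2 * ((d : ℝ) + 4)) * α₀) * (1 + 8 * (131072 * ((d : ℝ) + 1) ^ 2) * ((L : ℝ) ^ k * b)) ≤ 2)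
    (hc₃ : 2 * ((L : ℝ) ^ k * b) ≤ c3 d L) (hsm : 2048 * (d : ℝ) * ((L : ℝ) ^ k * b) ≤ 1)
    (hαP : 0 < αP) (hαP3 : C0 d * αP ≤ 1 / 3) (hαP2 : 2 * αP ≤ c2' d L) (hP : pdev (expCfg B * W) < αP * (((L : ℝ) ^ k)⁻¹) ^ 2)
    (hu₀u : ∀ x : Site d, u₀ x ∈ unitaryUnits (Matrix n n ℂ))
    (hu₀P : ∀ (x : Site d) (j : Fin d), u₀ (x + ((N * L ^ k : ℕ) : ℤ) • e j) = u₀ x)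
    (hu₀c : ∀ z : Site d, u₀ (((L : ℤ) ^ k) • z) = 1) (hrep₀ : gaugeAct u₀ UA = expCfg B * W) :
    ∃ v : Site d → (Matrix n n ℂ)ˣ,
      (∀ z : Site d, v (((L : ℤ) ^ k) • z) = vcov L W (expCfg B) k z) ∧
      (∀ i < k, ∀ (y : Site d) (r : Fin d → Fin L),
        Rc (hol (avgIter L W i) ((L : ℤ) • y) (treeWord (boxVec L r))) (uLev L v i ((L : ℤ) • y + boxVec L r)) = uLev L v i ((L : ℤ) • y)) ∧
      (∀ x : Site d, v x ∈ unitaryUnits (Matrix n n ℂ)) ∧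
      (∀ (x : Site d) (j : Fin d), v (x + ((N * L ^ k : ℕ) : ℤ) • e j) = v x) ∧
      gaugeAct (v * u₀) UA = mgauge W v (expCfg B) * W ∧
      vcov L W (mgauge W v (expCfg B)) k = uLev L (v * u₀) k ∧
      ∀ x : Site d, ‖(v x : Matrix n n ℂ) - 1‖ ≤ 64 * (d : ℝ) * ((L : ℝ) ^ k * b) := by
  obtain ⟨v, htop, hhier⟩ := exists_hier_extension (show 1 ≤ L by omega) W k (vcov L W (expCfg B) k)
  have htop' : ∀ z : Site d, v (((L : ℤ) ^ k) • z) = (u₀ (((L : ℤ) ^ k) • z))⁻¹ * vcov L W (expCfg B) k z := fun z => by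
    rw [htop z, hu₀c z, inv_one, one_mul]
  obtain ⟨hu, hp⟩ := unitary_periodic_of_hier hd hL k N hWu hWP hBu hBP hα hα3 hα4 h52 hb hB hsmall hc₃ hsm hαP hαP3 hαP2 hP
    hu₀u hu₀P htop' hhier
  obtain ⟨hrep, hframe⟩ := frameCondition L k hrep₀ hu₀c htop hhier
  exact ⟨v, htop, hhier, hu, hp, hrep, hframe, norm_frameGauge_sub_one_le hL k hWu hα hα3 hα4 h52 hb hB hsmall hc₃ hsm htop hhier⟩

/-- **THE ADMISSIBLE ZEROTH-ORDER FRAME GAUGE AT A LEVEL-`k` PAIR** (general unitary periodic pre-gauge; `Ū_Aᵏ = V = W̄ᵏ`): there is `v` such that the OUTPUT GAUGE `u := v·u₀` and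
the OUTPUT PERTURBATION `U′ := (e^{B})^{v}` are UNITARY and `(N·L^k)`-PERIODIC, `U_A^{u} = U′·W`, the frame condition `vcov L W U′ k = uLev L u k` holds, and
**(1.37) `dbavgCovIter L W U′ k = 1`** ([Balaban1985RegularSpaces] (1.37) with `B = 0`, i.e. (1.29), realised by an admissible gauge — at the zeroth order in (1.36)). [folklore] -/
theorem exists_admissibleFrameNormalised'_pair [Nonempty n] (hd : 1 ≤ d) {L : ℕ} (hL : 2 ≤ L) (k N : ℕ)
    {u₀ : Site d → (Matrix n n ℂ)ˣ} {UA W V : Site d → Fin d → (Matrix n n ℂ)ˣ} {B : Site d → Fin d → Matrix n n ℂ} {α₀ αP b : ℝ}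
    (hWu : ∀ (x : Site d) (κ : Fin d), W x κ ∈ unitaryUnits (Matrix n n ℂ))
    (hWP : ∀ (x : Site d) (κ : Fin d) (j : Fin d), W (x + ((N * L ^ k : ℕ) : ℤ) • e j) κ = W x κ)
    (hBu : ∀ (x : Site d) (κ : Fin d), expCfg B x κ ∈ unitaryUnits (Matrix n n ℂ))
    (hBP : ∀ (x : Site d) (κ : Fin d) (j : Fin d), expCfg B (x + ((N * L ^ k : ℕ) : ℤ) • e j) κ = expCfg B x κ)
    (hα : 0 < α₀) (hα3 : C0 d * α₀ ≤ 1 / 3) (hα4 : 4 * α₀ ≤ c2' d L) (h52 : pdev W < α₀ * (((L : ℝ) ^ k)⁻¹) ^ 2)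
    (hb : 0 ≤ b) (hB : ∀ (x : Site d) (κ : Fin d), ‖B x κ‖ ≤ b)
    (hsmall : Real.exp (4 * (800 * ((d : ℝ) + 1) ^ 2 * ((d : ℝ) + 4)) * α₀) * (1 + 8 * (131072 * ((d : ℝ) + 1) ^ 2) * ((L : ℝ) ^ k * b)) ≤ 2)
    (hc₃ : 2 * ((L : ℝ) ^ k * b) ≤ c3 d L) (hsm : 2048 * (d : ℝ) * ((L : ℝ) ^ k * b) ≤ 1)
    (hαP : 0 < αP) (hαP3 : C0 d * αP ≤ 1 / 3) (hαP2 : 2 * αP ≤ c2' d L) (hP : pdev (expCfg B * W) < αP * (((L : ℝ) ^ k)⁻¹) ^ 2)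
    (hu₀u : ∀ x : Site d, u₀ x ∈ unitaryUnits (Matrix n n ℂ))
    (hu₀P : ∀ (x : Site d) (j : Fin d), u₀ (x + ((N * L ^ k : ℕ) : ℤ) • e j) = u₀ x)
    (hrep₀ : gaugeAct u₀ UA = expCfg B * W) (hA : avgIter L UA k = V) (hW : avgIter L W k = V) :
    ∃ v : Site d → (Matrix n n ℂ)ˣ,
      (∀ x : Site d, (v * u₀) x ∈ unitaryUnits (Matrix n n ℂ)) ∧
      (∀ (x : Site d) (j : Fin d), (v * u₀) (x + ((N * L ^ k : ℕ) : ℤ) • e j) = (v * u₀) x) ∧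
      (∀ (x : Site d) (κ : Fin d), mgauge W v (expCfg B) x κ ∈ unitaryUnits (Matrix n n ℂ)) ∧
      (∀ (x : Site d) (κ : Fin d) (j : Fin d), mgauge W v (expCfg B) (x + ((N * L ^ k : ℕ) : ℤ) • e j) κ = mgauge W v (expCfg B) x κ) ∧
      gaugeAct (v * u₀) UA = mgauge W v (expCfg B) * W ∧
      vcov L W (mgauge W v (expCfg B)) k = uLev L (v * u₀) k ∧
      dbavgCovIter L W (mgauge W v (expCfg B)) k = 1 := by
  obtain ⟨v, -, -, hu, hp, hrep, hframe⟩ := exists_admissibleFrameNormalised' hd hL k N hWu hWP hBu hBP hα hα3 hα4 h52 hb hB hsmall hc₃ hsm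
    hαP hαP3 hαP2 hP hu₀u hu₀P hrep₀
  exact ⟨v, mul_mem_of hu hu₀u, fun x j => mul_add_period (fun y => hp y j) (fun y => hu₀P y j) x, mgauge_mem_of hWu hBu hu,
    fun x κ j => mgauge_add_period (fun y μ => hWP y μ j) (fun y μ => hBP y μ j) (fun y => hp y j) x κ, hrep, hframe,
    dbavgCovIter_eq_one_of_frame_eq' L k hrep hA hW hframe⟩

/-! ## §5 The size of the output perturbation: `‖U′^{v}(b) − 1‖ ≤ r + 2δ` — the located (0)-size face jump, as an upper bound -/

/-- **SIZE OF THE MOVING-FRAME TRANSFORM (55)**: for unitary `W`, `v`, `U′` with `‖v(x) − 1‖ ≤ δ` everywhere and `‖U′(b) − 1‖ ≤ r` bondwise,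
`‖U′^{v}(b) − 1‖ ≤ r + 2δ` (`U′^{v}(x,κ) = v(x)·U′(x,κ)·(R(W(x,κ))v(x+e_κ))⁻¹`, a product of three units of norm `≤ 1` within `δ`, `r`, `δ` of `1`;
`B8Lemma1NonAbelian.norm_units_mul_sub_one_le`, `FrameNormalisationSize.norm_Rc_sub_one`). [folklore] -/
theorem norm_mgauge_sub_one_le [Nonempty n] {W U' : Site d → Fin d → (Matrix n n ℂ)ˣ} {v : Site d → (Matrix n n ℂ)ˣ} {δ r : ℝ}
    (hWu : ∀ (x : Site d) (κ : Fin d), W x κ ∈ unitaryUnits (Matrix n n ℂ)) (hvu : ∀ x : Site d, v x ∈ unitaryUnits (Matrix n n ℂ))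
    (hUu : ∀ (x : Site d) (κ : Fin d), U' x κ ∈ unitaryUnits (Matrix n n ℂ))
    (hv : ∀ x : Site d, ‖(v x : Matrix n n ℂ) - 1‖ ≤ δ) (hU : ∀ (x : Site d) (κ : Fin d), ‖((U' x κ : (Matrix n n ℂ)ˣ) : Matrix n n ℂ) - 1‖ ≤ r)
    (x : Site d) (κ : Fin d) :
    ‖((mgauge W v U' x κ : (Matrix n n ℂ)ˣ) : Matrix n n ℂ) - 1‖ ≤ r + 2 * δ := by
  letI : CStarAlgebra (Matrix n n ℂ) := {}
  rw [mgauge_apply]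
  have ha : v x ∈ U1 (Matrix n n ℂ) := unitaryUnits_le_U1 (hvu x)
  have hb : U' x κ ∈ U1 (Matrix n n ℂ) := unitaryUnits_le_U1 (hUu x κ)
  have hR : Rc (W x κ) (v (x + e κ)) ∈ unitaryUnits (Matrix n n ℂ) := B7Prop8PrintedConstants.Rc_mem_unitaryUnits (hWu x κ) (hvu _)
  have hc : ‖(((Rc (W x κ) (v (x + e κ)))⁻¹ : (Matrix n n ℂ)ˣ) : Matrix n n ℂ) - 1‖ ≤ δ := by
    refine (norm_inv_sub_one_le (unitaryUnits_le_U1 hR)).trans ?_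
    rw [NE3.FrameNormalisationSize.norm_Rc_sub_one (hWu x κ)]
    exact hv _
  calc ‖((v x * U' x κ * (Rc (W x κ) (v (x + e κ)))⁻¹ : (Matrix n n ℂ)ˣ) : Matrix n n ℂ) - 1‖
      ≤ ‖((v x * U' x κ : (Matrix n n ℂ)ˣ) : Matrix n n ℂ) - 1‖ + ‖(((Rc (W x κ) (v (x + e κ)))⁻¹ : (Matrix n n ℂ)ˣ) : Matrix n n ℂ) - 1‖ :=
        B8Lemma1NonAbelian.norm_units_mul_sub_one_le ((U1 (Matrix n n ℂ)).mul_mem ha hb)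
    _ ≤ ‖(v x : Matrix n n ℂ) - 1‖ + ‖((U' x κ : (Matrix n n ℂ)ˣ) : Matrix n n ℂ) - 1‖
          + ‖(((Rc (W x κ) (v (x + e κ)))⁻¹ : (Matrix n n ℂ)ˣ) : Matrix n n ℂ) - 1‖ := by
        have h := B8Lemma1NonAbelian.norm_units_mul_sub_one_le (q := U' x κ) ha
        linarith
    _ ≤ δ + r + δ := add_le_add (add_le_add (hv x) (hU x κ)) hc
    _ = r + 2 * δ := by ring

/-- **THE ADMISSIBLE ZEROTH-ORDER FRAME GAUGE AT A LEVEL-`k` PAIR FROM A PINNED PRE-GAUGE, WITH BOTH SIZE LETTERS** (`u₀(L^kz) = 1`, `Ū_Aᵏ = V = W̄ᵏ`, `‖e^{B}(b) − 1‖ ≤ r`):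
there is `v` — unitary, `(N·L^k)`-periodic, within `64·d·L^k·b` of `1` — such that `u := v·u₀` and `U′ := (e^{B})^{v}` are unitary and `(N·L^k)`-periodic, `U_A^{u} = U′·W`,
`vcov L W U′ k = uLev L u k`, **(1.37) `dbavgCovIter L W U′ k = 1`**, and the OUTPUT LETTER **`‖U′(b) − 1‖ ≤ r + 128·d·L^k·b`** — at `b = s₁ξ`, `L^k = ξ⁻¹`: `r + 128·d·s₁`, the
located (0)-size of the exact realisation ((1.36) asks `(−1)`-size here; census R50's open half). [folklore] -/
theorem exists_admissibleFrameNormalised_pair [Nonempty n] (hd : 1 ≤ d) {L : ℕ} (hL : 2 ≤ L) (k N : ℕ)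
    {u₀ : Site d → (Matrix n n ℂ)ˣ} {UA W V : Site d → Fin d → (Matrix n n ℂ)ˣ} {B : Site d → Fin d → Matrix n n ℂ} {α₀ αP b r : ℝ}
    (hWu : ∀ (x : Site d) (κ : Fin d), W x κ ∈ unitaryUnits (Matrix n n ℂ))
    (hWP : ∀ (x : Site d) (κ : Fin d) (j : Fin d), W (x + ((N * L ^ k : ℕ) : ℤ) • e j) κ = W x κ)
    (hBu : ∀ (x : Site d) (κ : Fin d), expCfg B x κ ∈ unitaryUnits (Matrix n n ℂ))
    (hBP : ∀ (x : Site d) (κ : Fin d) (j : Fin d), expCfg B (x + ((N * L ^ k : ℕ) : ℤ) • e j) κ = expCfg B x κ)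
    (hBr : ∀ (x : Site d) (κ : Fin d), ‖((expCfg B x κ : (Matrix n n ℂ)ˣ) : Matrix n n ℂ) - 1‖ ≤ r)
    (hα : 0 < α₀) (hα3 : C0 d * α₀ ≤ 1 / 3) (hα4 : 4 * α₀ ≤ c2' d L) (h52 : pdev W < α₀ * (((L : ℝ) ^ k)⁻¹) ^ 2)
    (hb : 0 ≤ b) (hB : ∀ (x : Site d) (κ : Fin d), ‖B x κ‖ ≤ b)
    (hsmall : Real.exp (4 * (800 * ((d : ℝ) + 1) ^ 2 * ((d : ℝ) + 4)) * α₀) * (1 + 8 * (131072 * ((d : ℝ) + 1) ^ 2) * ((L : ℝ) ^ k * b)) ≤ 2)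
    (hc₃ : 2 * ((L : ℝ) ^ k * b) ≤ c3 d L) (hsm : 2048 * (d : ℝ) * ((L : ℝ) ^ k * b) ≤ 1)
    (hαP : 0 < αP) (hαP3 : C0 d * αP ≤ 1 / 3) (hαP2 : 2 * αP ≤ c2' d L) (hP : pdev (expCfg B * W) < αP * (((L : ℝ) ^ k)⁻¹) ^ 2)
    (hu₀u : ∀ x : Site d, u₀ x ∈ unitaryUnits (Matrix n n ℂ))
    (hu₀P : ∀ (x : Site d) (j : Fin d), u₀ (x + ((N * L ^ k : ℕ) : ℤ) • e j) = u₀ x)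
    (hu₀c : ∀ z : Site d, u₀ (((L : ℤ) ^ k) • z) = 1) (hrep₀ : gaugeAct u₀ UA = expCfg B * W)
    (hA : avgIter L UA k = V) (hW : avgIter L W k = V) :
    ∃ v : Site d → (Matrix n n ℂ)ˣ,
      (∀ x : Site d, v x ∈ unitaryUnits (Matrix n n ℂ)) ∧
      (∀ (x : Site d) (j : Fin d), v (x + ((N * L ^ k : ℕ) : ℤ) • e j) = v x) ∧
      (∀ x : Site d, ‖(v x : Matrix n n ℂ) - 1‖ ≤ 64 * (d : ℝ) * ((L : ℝ) ^ k * b)) ∧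
      (∀ x : Site d, (v * u₀) x ∈ unitaryUnits (Matrix n n ℂ)) ∧
      (∀ (x : Site d) (j : Fin d), (v * u₀) (x + ((N * L ^ k : ℕ) : ℤ) • e j) = (v * u₀) x) ∧
      (∀ (x : Site d) (κ : Fin d), mgauge W v (expCfg B) x κ ∈ unitaryUnits (Matrix n n ℂ)) ∧
      (∀ (x : Site d) (κ : Fin d) (j : Fin d), mgauge W v (expCfg B) (x + ((N * L ^ k : ℕ) : ℤ) • e j) κ = mgauge W v (expCfg B) x κ) ∧
      (∀ (x : Site d) (κ : Fin d), ‖((mgauge W v (expCfg B) x κ : (Matrix n n ℂ)ˣ) : Matrix n n ℂ) - 1‖ ≤ r + 128 * (d : ℝ) * ((L : ℝ) ^ k * b)) ∧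
      gaugeAct (v * u₀) UA = mgauge W v (expCfg B) * W ∧
      vcov L W (mgauge W v (expCfg B)) k = uLev L (v * u₀) k ∧
      dbavgCovIter L W (mgauge W v (expCfg B)) k = 1 := by
  obtain ⟨v, -, -, hu, hp, hrep, hframe, hsize⟩ := exists_admissibleFrameNormalised hd hL k N hWu hWP hBu hBP hα hα3 hα4 h52 hb hB hsmall
    hc₃ hsm hαP hαP3 hαP2 hP hu₀u hu₀P hu₀c hrep₀
  refine ⟨v, hu, hp, hsize, mul_mem_of hu hu₀u, fun x j => mul_add_period (fun y => hp y j) (fun y => hu₀P y j) x, mgauge_mem_of hWu hBu hu,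
    fun x κ j => mgauge_add_period (fun y μ => hWP y μ j) (fun y μ => hBP y μ j) (fun y => hp y j) x κ, fun x κ => ?_, hrep, hframe,
    dbavgCovIter_eq_one_of_frame_eq' L k hrep hA hW hframe⟩
  have h := norm_mgauge_sub_one_le hWu hu hBu hsize hBr x κ
  linarith

end

end Summit.QuantumFields.BalabanUV.T4Continuum.NE3.FrameNormalisationAdmissibleGauge
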